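import Mathlib
import Literature.Computability.AlgebraicComplexity.EquivariantDC
import Literature.Computability.AlgebraicComplexity.StandardFamilies
import HarnessLib

/-!
# ValiantsHypothesis / SymPencil — crux `EquivariantSdcNotQP` (stmt-ValiantsHypothesis-17792),
# line `Cruxes/SdcThesis/Lines/birth_EquivariantSdcNotQP.lean`: step (i) of the load-bearing stub
# `stub_permify` — NORMALISATION AT THE FIXED POINT (conjugation-equivariance)

The line card's plan for `stub_permify` ("linear lifts ⇒ permutation lifts at quasi-polynomial cost")
has three steps: (i) normalise at the `Γ_n`-fixed point `J` (the all-ones matrix, `per_n(J) = n! ≠ 0`)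
so that the exact lifts become CONJUGATIONS `B(γ·x) = g B(x) g⁻¹`; (ii) pass to a finite lift group;
(iii) embed its representation into a permutation representation of quasi-polynomial dimension.
This file proves step (i) as a helper (`--supports stmt-ValiantsHypothesis-17792 --as helper`):

* `eval_one_linSubst_of_mem` — every `γ` in `Γ_n = ⟨permutation matrices of π × ρ⟩ ≤ GL(n²)` fixes
  evaluation at the all-ones point (closure induction; generators act by `rename`);
* `per_n(J) = n!` (computed inline; the tree has it as `…Theorems.PrincipalMinorColouring.eval_one_perPoly`);
* `conjugationNormalForm` — from a `Γ_n`-equivariant affine determinantal representation `A` of `per_n`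
  (size `m`; symmetry of `A` is not needed for this step) one gets `B := A · (c · A(J)⁻¹)` with
  `det B = per_n` (`c^m = n!`, `IsAlgClosed.exists_pow_nat_eq`), `B(J) = c · 1`, and for every
  `γ ∈ Γ_n` a `g ∈ GL_m(ℂ)` with `B(γ·x) = g B(x) g⁻¹` — because evaluating the lift identity at the
  fixed point gives `A(J) = g A(J) h⁻¹`, i.e. `h⁻¹ A(J)⁻¹ = A(J)⁻¹ g⁻¹`.

Honest framing: a helper for an OPEN, L-sized stub (steps (ii)–(iii) are untouched — they are where
the representation theory lives); the crux `SymPencil.EquivariantSdcNotQP` stays OPEN (open-problem grade);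
`VP ≠ VNP` is NOT proved and nothing here is progress on it. No new definitions, no named facts.
-/

noncomputable section

-- `Summit.ValiantsHypothesis.ValiantsHypothesis.…` is the tree's mandated single-conjunct layout
-- (Sub = Summit), so the duplicated namespace component is intended.
set_option linter.dupNamespace false

namespace Summit.ValiantsHypothesis.ValiantsHypothesis.Theorems.SymPencilEquivariantSdcNotQP

open Literature.Computability.AlgebraicComplexity MvPolynomial Matrix

/-! ### The fixed point `J` -/

/-- **`Γ_n` fixes evaluation at the all-ones point.** For every `γ` in the subgroup of `GL(n², ℂ)`
generated by the permutation matrices of the row/column permutation pairs, and every polynomial `p`,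
`p(γ · J) = p(J)` where `J = (1, …, 1)`: the generators act by renaming the variables
(`linSubst_permMatrix`). [folklore] -/
theorem eval_one_linSubst_of_mem {n : ℕ} {γ : GL (Fin n × Fin n) ℂ}
    (hγ : γ ∈ Subgroup.closure {γ : GL (Fin n × Fin n) ℂ | ∃ π ρ : Equiv.Perm (Fin n),
      (γ : Matrix (Fin n × Fin n) (Fin n × Fin n) ℂ) = Equiv.Perm.permMatrix ℂ (Equiv.prodCongr π ρ)})
    (p : MvPolynomial (Fin n × Fin n) ℂ) :
    MvPolynomial.eval (fun _ => (1 : ℂ))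
        (linSubst (Fin n × Fin n) ℂ (γ : Matrix (Fin n × Fin n) (Fin n × Fin n) ℂ) p) =
      MvPolynomial.eval (fun _ => (1 : ℂ)) p := by
  induction hγ using Subgroup.closure_induction generalizing p with
  | mem γ hγ =>
    obtain ⟨π, ρ, hπρ⟩ := hγ
    rw [hπρ, linSubst_permMatrix, eval_rename]
    rfl
  | one =>
    rw [Units.val_one, linSubst_one, AlgHom.id_apply]
  | mul γ δ _ _ ihγ ihδ =>
    rw [Units.val_mul, linSubst_mul, AlgHom.comp_apply, ihγ, ihδ]
  | inv γ _ ih =>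
    have h1 : linSubst (Fin n × Fin n) ℂ (γ : Matrix _ _ ℂ)
        (linSubst (Fin n × Fin n) ℂ ((γ⁻¹ : GL (Fin n × Fin n) ℂ) : Matrix _ _ ℂ) p) = p := by
      rw [← AlgHom.comp_apply, ← linSubst_mul, ← Units.val_mul, mul_inv_cancel, Units.val_one,
        linSubst_one, AlgHom.id_apply]
    conv_rhs => rw [← h1]
    rw [ih]

/-- Evaluating an equivariance identity at `J`: if `A(γ·x) = g A(x) h⁻¹` for some `γ ∈ Γ_n`, then
`A(J) = g A(J) h⁻¹`. [folklore] -/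
theorem eval_one_lift {n m : ℕ} {γ : GL (Fin n × Fin n) ℂ}
    (hγ : γ ∈ Subgroup.closure {γ : GL (Fin n × Fin n) ℂ | ∃ π ρ : Equiv.Perm (Fin n),
      (γ : Matrix (Fin n × Fin n) (Fin n × Fin n) ℂ) = Equiv.Perm.permMatrix ℂ (Equiv.prodCongr π ρ)})
    {A : Matrix (Fin m) (Fin m) (MvPolynomial (Fin n × Fin n) ℂ)} {g h : GL (Fin m) ℂ}
    (hlift : Matrix.linSubstEntries γ A =
      (g : Matrix (Fin m) (Fin m) ℂ).map MvPolynomial.C * A *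
        ((h⁻¹ : GL (Fin m) ℂ) : Matrix (Fin m) (Fin m) ℂ).map MvPolynomial.C) :
    A.map (MvPolynomial.eval fun _ => (1 : ℂ)) =
      (g : Matrix (Fin m) (Fin m) ℂ) * A.map (MvPolynomial.eval fun _ => (1 : ℂ)) *
        ((h⁻¹ : GL (Fin m) ℂ) : Matrix (Fin m) (Fin m) ℂ) := by
  have hev := congrArg (fun M : Matrix (Fin m) (Fin m) (MvPolynomial (Fin n × Fin n) ℂ) =>
    M.map (MvPolynomial.eval fun _ => (1 : ℂ))) hlift
  have hL : (Matrix.linSubstEntries γ A).map (MvPolynomial.eval fun _ => (1 : ℂ)) =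
      A.map (MvPolynomial.eval fun _ => (1 : ℂ)) := by
    ext a b
    simp only [Matrix.linSubstEntries, Matrix.map_apply]
    exact eval_one_linSubst_of_mem hγ (A a b)
  have hC : ∀ M : Matrix (Fin m) (Fin m) ℂ,
      (M.map (MvPolynomial.C : ℂ → MvPolynomial (Fin n × Fin n) ℂ)).map
        (MvPolynomial.eval fun _ => (1 : ℂ)) = M := by
    intro M
    ext a b
    simp [Matrix.map_apply]
  rw [hL, Matrix.map_mul, Matrix.map_mul, hC, hC] at hev
  exact hev

/-! ### Step (i) of `stub_permify`: conjugation normal form -/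

/-- **Conjugation normal form** (step (i) of the line's `stub_permify`).  A `Γ_n`-equivariant affine
determinantal representation `A` of `per_n` (exact `GL_m × GL_m` lifts, tree `IsEquivariantDetRepr`)
can be renormalised, at the SAME size, to `B` with `det B = per_n`, `B(J) = c · 1` (`c ≠ 0`, `J` the
all-ones point) and CONJUGATION lifts `B(γ · x) = g B(x) g⁻¹` for every `γ ∈ Γ_n`.
`Γ_n` is spelled VERBATIM as in the route statement `Theses/SymPencil.lean :: EquivariantSdcNotQP`
(closure of the permutation matrices of `Equiv.prodCongr π ρ`; no torus, so it fixes `J`).  Construction: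
`B = A · K` with the constant matrix `K = c · A(J)⁻¹`, where `A(J) ∈ GL_m(ℂ)` because
`det A(J) = per_n(J) = n! ≠ 0` (characteristic `0`) and `c^m = n!` (`IsAlgClosed.exists_pow_nat_eq`;
`c = 1` if `m = 0`) is exactly the choice making `det B = per_n · c^m / n! = per_n`. [folklore] -/
theorem conjugationNormalForm (n m : ℕ) (A : Matrix (Fin m) (Fin m) (MvPolynomial (Fin n × Fin n) ℂ))
    (hA : IsEquivariantDetRepr (Subgroup.closure {γ : GL (Fin n × Fin n) ℂ | ∃ π ρ : Equiv.Perm (Fin n),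
      (γ : Matrix (Fin n × Fin n) (Fin n × Fin n) ℂ) = Equiv.Perm.permMatrix ℂ (Equiv.prodCongr π ρ)})
      (perPoly (Fin n) ℂ) A) :
    ∃ B : Matrix (Fin m) (Fin m) (MvPolynomial (Fin n × Fin n) ℂ),
      IsAffineDetRepr (perPoly (Fin n) ℂ) B ∧
      (∃ c : ℂ, c ≠ 0 ∧ B.map (MvPolynomial.eval fun _ => (1 : ℂ)) = c • (1 : Matrix (Fin m) (Fin m) ℂ)) ∧
      ∀ γ ∈ Subgroup.closure {γ : GL (Fin n × Fin n) ℂ | ∃ π ρ : Equiv.Perm (Fin n),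
          (γ : Matrix (Fin n × Fin n) (Fin n × Fin n) ℂ) = Equiv.Perm.permMatrix ℂ (Equiv.prodCongr π ρ)},
        ∃ g : GL (Fin m) ℂ, Matrix.linSubstEntries γ B =
          (g : Matrix (Fin m) (Fin m) ℂ).map MvPolynomial.C * B *
            ((g⁻¹ : GL (Fin m) ℂ) : Matrix (Fin m) (Fin m) ℂ).map MvPolynomial.C := by
  obtain ⟨⟨hdeg, hdet⟩, hlifts⟩ := hA
  set ev : MvPolynomial (Fin n × Fin n) ℂ →+* ℂ := MvPolynomial.eval fun _ => (1 : ℂ) with hev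
  set AJ : Matrix (Fin m) (Fin m) ℂ := A.map ev with hAJ
  -- `det A(J) = n! ≠ 0`
  have hdetAJ : AJ.det = (Nat.factorial n : ℂ) := by
    have h := RingHom.map_det ev A
    rw [hdet] at h
    rw [hAJ, ← RingHom.mapMatrix_apply, ← h, hev, eval_perPoly]
    -- `per_n(J) = n!` (also in the tree as `…Theorems.PrincipalMinorColouring.eval_one_perPoly`,
    -- not imported here to stay out of that route's cone)
    simp [Matrix.permanent, Fintype.card_perm]
  have hfact : (Nat.factorial n : ℂ) ≠ 0 := by exact_mod_cast Nat.factorial_ne_zero n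
  have hAJunit : IsUnit AJ.det := by rw [hdetAJ]; exact isUnit_iff_ne_zero.2 hfact
  -- the scalar `c` with `c^m = n!` (for `m = 0` take `c = 1`)
  obtain ⟨c, hc, hcm⟩ : ∃ c : ℂ, c ≠ 0 ∧ (c ^ m * (AJ.det)⁻¹ = 1) := by
    rcases Nat.eq_zero_or_pos m with hm | hm
    · subst hm
      refine ⟨1, one_ne_zero, ?_⟩
      rw [pow_zero, one_mul, Matrix.det_isEmpty, inv_one]
    · obtain ⟨z, hz⟩ := IsAlgClosed.exists_pow_nat_eq (Nat.factorial n : ℂ) hm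
      refine ⟨z, ?_, ?_⟩
      · intro h0
        rw [h0, zero_pow hm.ne'] at hz
        exact hfact hz.symm
      · rw [hz, hdetAJ, mul_inv_cancel₀ hfact]
  -- the constant matrix `K = c · A(J)⁻¹` and `B = A · K`
  set K : Matrix (Fin m) (Fin m) ℂ := c • AJ⁻¹ with hK
  have hdetK : K.det = 1 := by
    rw [hK, Matrix.det_smul, Fintype.card_fin, Matrix.det_nonsing_inv, Ring.inverse_eq_inv']
    exact hcm
  refine ⟨A * K.map MvPolynomial.C, ⟨?_, ?_⟩, ⟨c, hc, ?_⟩, ?_⟩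
  · -- affine entries
    intro a b
    rw [Matrix.mul_apply]
    refine (MvPolynomial.totalDegree_finsetSum _ _).trans (Finset.sup_le fun x _ => ?_)
    refine (MvPolynomial.totalDegree_mul _ _).trans ?_
    rw [Matrix.map_apply, MvPolynomial.totalDegree_C, add_zero]
    exact hdeg a x
  · -- determinant
    rw [Matrix.det_mul, hdet, ← RingHom.mapMatrix_apply, ← RingHom.map_det, hdetK, map_one, mul_one]
  · -- value at `J`
    have hKev : (K.map MvPolynomial.C).map ev = K := by
      ext a b
      simp [Matrix.map_apply, hev]
    rw [Matrix.map_mul, hKev, ← hAJ, hK, Matrix.mul_smul, Matrix.mul_nonsing_inv _ hAJunit]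
  · -- conjugation lifts
    intro γ hγ
    obtain ⟨g, h, hlift⟩ := hlifts γ hγ
    refine ⟨g, ?_⟩
    -- at `J`: `A(J) = g A(J) h⁻¹`, hence `h⁻¹ K = K g⁻¹`
    have hJ := eval_one_lift hγ hlift
    rw [← hev, ← hAJ] at hJ
    have hcomm : ((h⁻¹ : GL (Fin m) ℂ) : Matrix (Fin m) (Fin m) ℂ) * K =
        K * ((g⁻¹ : GL (Fin m) ℂ) : Matrix (Fin m) (Fin m) ℂ) := by
      -- `h⁻¹ A(J)⁻¹` is a left inverse of `g A(J)`
      have hgA : (g : Matrix (Fin m) (Fin m) ℂ) * AJ = AJ * (h : Matrix (Fin m) (Fin m) ℂ) := by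
        calc (g : Matrix (Fin m) (Fin m) ℂ) * AJ
            = (g : Matrix (Fin m) (Fin m) ℂ) * AJ *
                (((h⁻¹ : GL (Fin m) ℂ) : Matrix (Fin m) (Fin m) ℂ) * (h : Matrix (Fin m) (Fin m) ℂ)) := by
              rw [← Units.val_mul, inv_mul_cancel, Units.val_one, Matrix.mul_one]
          _ = ((g : Matrix (Fin m) (Fin m) ℂ) * AJ * ((h⁻¹ : GL (Fin m) ℂ) : Matrix (Fin m) (Fin m) ℂ)) *
                (h : Matrix (Fin m) (Fin m) ℂ) := by
              simp only [Matrix.mul_assoc]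
          _ = AJ * (h : Matrix (Fin m) (Fin m) ℂ) := by rw [← hJ]
      have hleft : (((h⁻¹ : GL (Fin m) ℂ) : Matrix (Fin m) (Fin m) ℂ) * AJ⁻¹) *
          ((g : Matrix (Fin m) (Fin m) ℂ) * AJ) = 1 := by
        rw [hgA, Matrix.mul_assoc, ← Matrix.mul_assoc AJ⁻¹, Matrix.nonsing_inv_mul _ hAJunit,
          Matrix.one_mul, ← Units.val_mul, inv_mul_cancel, Units.val_one]
      have hinv : ((g : Matrix (Fin m) (Fin m) ℂ) * AJ)⁻¹ =
          ((h⁻¹ : GL (Fin m) ℂ) : Matrix (Fin m) (Fin m) ℂ) * AJ⁻¹ := Matrix.inv_eq_left_inv hleft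
      rw [Matrix.mul_inv_rev, ← Matrix.coe_units_inv] at hinv
      rw [hK, Matrix.mul_smul, Matrix.smul_mul, ← hinv]
    calc Matrix.linSubstEntries γ (A * K.map MvPolynomial.C)
        = Matrix.linSubstEntries γ A * K.map MvPolynomial.C := by
          simp only [Matrix.linSubstEntries]
          rw [Matrix.map_mul]
          congr 1
          ext a b
          simp [Matrix.map_apply]
      _ = (g : Matrix (Fin m) (Fin m) ℂ).map MvPolynomial.C * A *
            ((((h⁻¹ : GL (Fin m) ℂ) : Matrix (Fin m) (Fin m) ℂ) * K).map MvPolynomial.C) := by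
          rw [hlift, Matrix.map_mul, Matrix.mul_assoc]
      _ = (g : Matrix (Fin m) (Fin m) ℂ).map MvPolynomial.C * A *
            ((K * ((g⁻¹ : GL (Fin m) ℂ) : Matrix (Fin m) (Fin m) ℂ)).map MvPolynomial.C) := by
          rw [hcomm]
      _ = (g : Matrix (Fin m) (Fin m) ℂ).map MvPolynomial.C * (A * K.map MvPolynomial.C) *
            ((g⁻¹ : GL (Fin m) ℂ) : Matrix (Fin m) (Fin m) ℂ).map MvPolynomial.C := by
          rw [Matrix.map_mul, ← Matrix.mul_assoc, Matrix.mul_assoc _ A]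

end Summit.ValiantsHypothesis.ValiantsHypothesis.Theorems.SymPencilEquivariantSdcNotQP

end
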